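import Summits.HodgeConjecture.HodgeConjecture.Theses.DworkReflectionQuotients
import Literature.AlgebraicGeometry.HodgeTheory.DworkSexticTopCharacter

/-!
# Crux K2 `FlatClassesSpannedByReflectionInvariants`: the flat types `j = 0, 2, 3` UNCONDITIONALLY,
# and the route decl modulo statements about the Fermat sextic fourfold alone

Route `route-HodgeConjecture-DworkReflectionQuotients` (cell `hodge-nonav`, rung F-H1 — never summit
credit), item `stmt-HodgeConjecture-20241`; landed `--supports stmt-HodgeConjecture-20241`. Prover seat
`hodge-nonav-20241-p1` (g4), 2026-08-27.

The g3 theorem `DworkSextic.flatClasses_mem_span_reflInvariant_of_topCharacter`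
(`Literature/…/DworkSexticTransportData`) proved the crux body for the flat types `j = 0, 2, 3` (810 of
the 1170 flat classes) modulo ONE statement `hZ` about `X_ψ`: the `Γ_W`-eigenclasses of `H⁴(X_ψ(ℂ); ℂ)`
of non-trivial character and Hodge type `(4,0)` vanish. That statement is now a THEOREM of the tree
(`DworkSextic.topCharacter_trivial`, file `Literature/…/DworkSexticTopCharacter`; Calabi–Yau Liouville on
Griffiths' residue form, `det = ∏ aᵢ = 1` on `Γ_W`). Hence:

* `flatClassesSpannedByReflectionInvariants_of_ne_one` — **the crux body for `j ≠ 1`, UNCONDITIONAL**;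
* `flatClassesSpannedByReflectionInvariants_of_typeOneHodge` — **the whole route decl from child 2
  `TypeOneHodge` alone** (purity of the type `(1,2,2,3,5,5) ∘ σ`; `j ≠ 1` unconditionally, `j = 1` by the
  six-reflection averaging `DworkSextic.mem_span_reflInvariant_of_isEig_add`);
* `flatClassesSpannedByReflectionInvariants_of_fermatTypeOne` — the route decl from the purity `(2,2)` of
  the `Γ_W`-pieces of `χ_{(1,2,2,3,5,5)∘σ}`, `χ_{(5,4,4,3,1,1)∘σ}` of the FERMAT fourfold `X⁴₆`
  (transport + Hodge–Riemann + trivial top character, `DworkSextic.isOfHodgeType_two_two_typeOne_of_fermat`);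
* `flatClassesSpannedByReflectionInvariants_of_fermatClaims` — the route decl from FOUR explicit
  algebraic-cycle statements `claim(α)` on `X⁴₆`, `α = (1,2,2,3,5,5), (3,4,4,5,1,1), (5,4,4,3,1,1),
  (3,2,2,1,5,5)` (the sharpest residual form of the crux);
* `flatClassesSpannedByReflectionInvariants_of_shioda` — the route decl modulo the named fact
  `Shioda1979_claim_semiDecomposable` (Shioda 1979 PJA §4 / Ran 1980 §4): a THIRD independent conditional
  closure of the crux, next to `…K2ModuloKatz` (Katz 2009) and `…K2OfGriffiths` (Griffiths 1969), and the
  first resting on algebraic cycles of the Fermat fourfold only.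

## References

* N. M. Katz, *Another look at the Dwork family*, Progr. Math. 270 (2009), §3, Lemma 3.1. [Katz2009]
* T. Shioda, *The Hodge conjecture and the Tate conjecture for Fermat varieties*, Proc. Japan Acad. 55A
  (1979), §1 (iii), §4. [Shioda1979PJA]
* Z. Ran, *Cycles on Fermat hypersurfaces*, Compositio Math. 42 (1980), §4 Cor. 4.7. [Ran1980]
* C. Voisin, *Hodge Theory and Complex Algebraic Geometry I* (2002), §6.3.2 Thm. 6.32. [VoisinHodgeI2002]
* G. Bini, A. Garbagnati, *Quotients of the Dwork pencil*, J. Geom. Phys. 75 (2014), §3.4. [BiniGarbagnati2012]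
-/

namespace Summit.HodgeConjecture.HodgeConjecture.Theorems

open Literature.AlgebraicGeometry.HodgeTheory Literature.AlgebraicGeometry.Motives
open Literature.AlgebraicTopology.SingularHomology

/-- **Crux K2 for the flat types `j = 0, 2, 3` — unconditional.** For `ψ⁶ ≠ 1`, `j ≠ 1`, `σ ∈ 𝔖₆`
and every rational `w = u + v` with `u` an eigenclass of exponent `flatTypes j ∘ σ` and `v` one of
exponent `(6 − flatTypes j) ∘ σ`, the class `w` lies in the `ℂ`-span of the rational `(2,2)`-classes
fixed by a realised reflection: `DworkSextic.flatClasses_mem_span_reflInvariant_of_topCharacter` with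
its hypothesis `hZ` discharged by `DworkSextic.topCharacter_trivial`. Relies on nothing unproved.
[cite: Katz2009, §3 and Lemma 3.1] [cite: VoisinHodgeI2002, §6.3.2 Thm. 6.32] [cite: BiniGarbagnati2012, §3.4] -/
theorem flatClassesSpannedByReflectionInvariants_of_ne_one
    {ψ : ℂ} (hψ : ψ ^ 6 ≠ 1) (j : Fin 4) (hj : j ≠ 1) (σ : Equiv.Perm (Fin 6))
    (w : complexBetti (DworkSextic.fibre ψ) (2 * 2)) (hrat : IsRationalClass w)
    (huv : ∃ u v : complexBetti (DworkSextic.fibre ψ) (2 * 2),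
      DworkSextic.IsEig ψ (fun l => DworkSextic.flatTypes j (σ l)) u ∧
      DworkSextic.IsEig ψ (fun l => 6 - DworkSextic.flatTypes j (σ l)) v ∧ w = u + v) :
    w ∈ Submodule.span ℂ {c : complexBetti (DworkSextic.fibre ψ) (2 * 2) | IsRationalClass c ∧
      IsOfHodgeType 4 (DworkSextic.fibre ψ) (2 * 2) 2 2 c ∧ ∃ i i' : Fin 6, i ≠ i' ∧ ∃ ζ : ℂ, ζ ^ 6 = 1 ∧
        ∃ g : C(ComplexPoints (DworkSextic.fibre ψ), ComplexPoints (DworkSextic.fibre ψ)),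
          (∀ x, ∃ t : ℂ, (DworkSextic.pt ψ (g x)).rep = t • (fun k => if k = i then ζ * (DworkSextic.pt ψ x).rep i'
            else if k = i' then ζ⁻¹ * (DworkSextic.pt ψ x).rep i else (DworkSextic.pt ψ x).rep k)) ∧
          singularCohomology.map ℂ ℂ g (2 * 2) c = c} :=
  DworkSextic.flatClasses_mem_span_reflInvariant_of_topCharacter hψ j hj σ (DworkSextic.topCharacter_trivial hψ)
    w hrat huv

/-- **The route decl `FlatClassesSpannedByReflectionInvariants` from child 2 `TypeOneHodge` alone.**
The flat types `j ≠ 1` are unconditional (`flatClassesSpannedByReflectionInvariants_of_ne_one`); for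
`j = 1` the hypothesis gives the purity `(2,2)` of both summands `u`, `v`, and the six-reflection averaging
(`DworkSextic.mem_span_reflInvariant_of_isEig_add`, reflections `s_(σ⁻¹0, σ⁻¹5, ζ)` where the exponents
differ) concludes. CONDITIONAL on `TypeOneHodge` (item stmt-HodgeConjecture-21152) only.
[cite: Katz2009, Lemma 3.1 and §2 pp. 5–7] [cite: BiniGarbagnati2012, §3.4] -/
theorem flatClassesSpannedByReflectionInvariants_of_typeOneHodge
    (hJ1 : Summit.HodgeConjecture.HodgeConjecture.Theses.DworkReflectionQuotients.TypeOneHodge) :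
    Summit.HodgeConjecture.HodgeConjecture.Theses.DworkReflectionQuotients.FlatClassesSpannedByReflectionInvariants := by
  intro ψ hψ F X pt IsEig IsRefl j σ w hw huv
  by_cases hj : j = 1
  · subst hj
    obtain ⟨u, v, hu, hv, hwuv⟩ := huv
    obtain ⟨hu2, hv2⟩ := hJ1 ψ hψ σ u v hu hv
    obtain ⟨hne, hne'⟩ := DworkSextic.flatTypes_zero_ne_five 1
    have hij : σ.symm 0 ≠ σ.symm 5 := fun h => by simpa using congrArg σ h
    exact DworkSextic.mem_span_reflInvariant_of_isEig_add hψ hij (e := fun l => DworkSextic.flatTypes 1 (σ l))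
      (e' := fun l => 6 - DworkSextic.flatTypes 1 (σ l)) (by simpa using hne) (by simpa using hne') hu hv hwuv hw
      (hwuv ▸ hu2.add (DworkSextic.isSmoothProjective_fibre hψ) hv2)
  · exact flatClassesSpannedByReflectionInvariants_of_ne_one hψ j hj σ w hw huv

/-- **The route decl from the Fermat sextic fourfold alone**: if for every `σ ∈ 𝔖₆` and every Hodge
model `A₀` of `X⁴₆` the `Γ_W`-eigenspaces of `χ_{(1,2,2,3,5,5)∘σ}` and `χ_{(5,4,4,3,1,1)∘σ}` in
`H⁴(X⁴₆(ℂ); ℂ)` pull back into `H^{2,2}_{A₀}`, then `FlatClassesSpannedByReflectionInvariants` holds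
(`DworkSextic.isOfHodgeType_two_two_typeOne_of_fermat` supplies `TypeOneHodge`). CONDITIONAL on the
displayed hypothesis only (no named fact). [cite: Katz2009, Lemma 3.1] [cite: VoisinHodgeI2002, §6.3.2 Thm. 6.32]
[cite: BiniGarbagnati2012, §3.4] -/
theorem flatClassesSpannedByReflectionInvariants_of_fermatTypeOne
    (hF1 : ∀ (σ : Equiv.Perm (Fin 6)) (A₀ : HodgeModel 4 (fermatHypersurface 4 6)),
      (∀ c ∈ diagonalCharacterEigenspace (fermatPolynomial ℂ 4 6) DworkSextic.gammaW
        (DworkSextic.character fun l => DworkSextic.flatTypes 1 (σ l)) (2 * 2),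
          A₀.pullback (2 * 2) c ∈ A₀.hodgePQ (2 * 2) 2 2) ∧
      (∀ c ∈ diagonalCharacterEigenspace (fermatPolynomial ℂ 4 6) DworkSextic.gammaW
        (DworkSextic.character fun l => 6 - DworkSextic.flatTypes 1 (σ l)) (2 * 2),
          A₀.pullback (2 * 2) c ∈ A₀.hodgePQ (2 * 2) 2 2)) :
    Summit.HodgeConjecture.HodgeConjecture.Theses.DworkReflectionQuotients.FlatClassesSpannedByReflectionInvariants :=
  flatClassesSpannedByReflectionInvariants_of_typeOneHodge fun _ hψ σ _ _ hu hv =>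
    DworkSextic.isOfHodgeType_two_two_typeOne_of_fermat hψ σ (hF1 σ) hu hv

/-- **The route decl from four explicit algebraic-cycle statements on the Fermat sextic fourfold**:
if the torus eigenlines `V(1,2,2,3,5,5)`, `V(3,4,4,5,1,1)`, `V(5,4,4,3,1,1)`, `V(3,2,2,1,5,5)` of
`H⁴(X⁴₆(ℂ); ℂ)` lie in the `ℂ`-span of the classes of algebraic `2`-cycles (`FermatCharacter.Claim 6 2`;
the last two are the complex conjugates of the first two), then `FlatClassesSpannedByReflectionInvariants`
holds (`DworkSextic.isOfHodgeType_two_two_typeOne_of_claims`). CONDITIONAL on the four displayed claims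
only (no named fact); this is the sharpest residual form of the crux. [cite: Katz2009, Lemma 3.1]
[cite: Shioda1979PJA, §4] [cite: BiniGarbagnati2012, §3.4] -/
theorem flatClassesSpannedByReflectionInvariants_of_fermatClaims
    (h₁ : FermatCharacter.Claim 6 2 ![1, 2, 2, 3, 5, 5]) (h₂ : FermatCharacter.Claim 6 2 ![3, 4, 4, 5, 1, 1])
    (h₃ : FermatCharacter.Claim 6 2 ![5, 4, 4, 3, 1, 1]) (h₄ : FermatCharacter.Claim 6 2 ![3, 2, 2, 1, 5, 5]) :
    Summit.HodgeConjecture.HodgeConjecture.Theses.DworkReflectionQuotients.FlatClassesSpannedByReflectionInvariants :=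
  flatClassesSpannedByReflectionInvariants_of_typeOneHodge fun _ hψ σ _ _ hu hv =>
    DworkSextic.isOfHodgeType_two_two_typeOne_of_claims h₁ h₂ h₃ h₄ hψ σ hu hv

/-- **Crux K2 `FlatClassesSpannedByReflectionInvariants` modulo Shioda's theorem on the
semi-decomposable Hodge characters of the Fermat fourfold** (the tree's named fact
`Shioda1979_claim_semiDecomposable`, Shioda 1979 PJA §1 (iii), §4 / Ran 1980 §4 Cor. 4.7): the
flat types `j = 0, 2, 3` unconditionally, the type `j = 1` by `DworkSextic.isOfHodgeType_two_two_typeOne_of_shioda`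
(its totally nonzero translates `(1,2,2,3,5,5)`, `(3,4,4,5,1,1)` and conjugates are semi-decomposable,
hence spanned by algebraic cycles, hence `(2,2)` at the Fermat point, and the purity is transported along
the Dwork line). CONDITIONAL on the named fact `Shioda1979_claim_semiDecomposable` (a conditional-result);
compare `flatClassesSpannedByReflectionInvariants_of_katz` (Katz 2009) and `…_of_griffiths` (Griffiths 1969).
[cite: Shioda1979PJA, §1 Definition (iii) and §4] [cite: Ran1980, §4 Cor. 4.7] [cite: Katz2009, Lemma 3.1]
[cite: BiniGarbagnati2012, §3.4] -/
theorem flatClassesSpannedByReflectionInvariants_of_shioda (hS : Shioda1979_claim_semiDecomposable) :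
    Summit.HodgeConjecture.HodgeConjecture.Theses.DworkReflectionQuotients.FlatClassesSpannedByReflectionInvariants :=
  flatClassesSpannedByReflectionInvariants_of_typeOneHodge fun _ hψ σ _ _ hu hv =>
    DworkSextic.isOfHodgeType_two_two_typeOne_of_shioda hS hψ σ hu hv

end Summit.HodgeConjecture.HodgeConjecture.Theorems
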